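import Summits.CriticalPhenomena.PercolationContinuityZ3.Theorems.PercNearOneGluingNoHeavyLowerTailAntitheticHandleDual
import Summits.CriticalPhenomena.PercolationContinuityZ3.Theorems.PercNearOneGluingNoHeavyLowerTailAntitheticTransport
import Summits.CriticalPhenomena.PercolationContinuityZ3.Theorems.PercNearOneGluingNoHeavyLowerTailAntitheticK5Oplus
import Summits.CriticalPhenomena.PercolationContinuityZ3.Theorems.PercNearOneGluingNoHeavyLowerTailAntitheticApexMixed
import HarnessLib

/-!
# `NoHeavyLowerTail` (stmt-CriticalPhenomena-4575) — antithetic cluster pairs: **THEOREM K5H — `K₅` PLUS A HANDLE** (the vertex antithetic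
# inequality at `R = {x}` / CONJECTURE Δ2 for the complete graph on five vertices with an ear through `x`, ALL arm lengths;
# prim-hp-2 gen 64, HOME/MEMO-gen64.md §3)

Support file (`--supports stmt-CriticalPhenomena-4575`, hull-port prover `prim-hp-2`, gen 64).  No definitions, no named facts, no sorries;
standard axioms (the ⊕-input …AntitheticK5Oplus is a `native_decide`-checked certificate).  VERTEX version.

THE GRAPH.  `K = K₅` on `c 0 = s, …, c 4` (`c : Fin 5 → V` injective; edge set `E₀ = Sym2.map c ''` {all ten pairs}), a handle
`P = c 1 – u 1 – … – u a = y – x – z = w b – … – w 1 – Q = c q` (any `q`; arms of fresh vertices, `a, b ≥ 0`; `x` fresh; `yz ∉ H`).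
`λ(s, P) = 4`: no box theorem reaches it; with …AntitheticK4Handle this makes `K_n + handle` a tree theorem for `n = 4, 5`:
* `Antithetic.K5.handle_vertex_sum_nonneg` — **THEOREM K5H**: for all monotone `F, G`,
  `0 ≤ Σ_{ω : ¬(x ∈ X_E ω ∧ x ∈ Y_E ω)} (F(X_E ω) − F(Y_E ω))·(G(X_E ω) − G(Y_E ω))`, `E = K₅ ∪ arms + xy + xz`.
PROOF = the DUAL HANDLE THEOREM (…AntitheticHandleDual: (⊕) + (M) for the base graph only, via the 1-SUM LEMMA) with
(⊕) = the checked pair-cube certificate `Antithetic.K5.oplus_powerset` on `Fin 5` TRANSPORTED along `c` (`Antithetic.Transport.oplus_of_powerset`)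
and (M) = `Antithetic.Apex.mixed_nonneg` (every vertex of `K₅` is an apex).
[cite: VandenbergHaggstromKahn2005, §1 p. 6 ("Harris' inequality"), §1 p. 3 (open cluster `C_s`)]
-/

noncomputable section

namespace Summit.CriticalPhenomena.PercolationContinuityZ3.Theorems

open Literature.Probability.Percolation
open scoped Classical

namespace Antithetic

namespace K5

variable {V : Type*} {c : Fin 5 → V} (hc : Function.Injective c) {E₀ : Set (Sym2 V)}
  (hE₀ : E₀ = Sym2.map c '' ↑({s(0, 1), s(0, 2), s(0, 3), s(0, 4), s(1, 2), s(1, 3), s(1, 4), s(2, 3), s(2, 4), s(3,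
    4)} : Finset (Sym2 (Fin 5))))
include hc hE₀

variable [Fintype V] {q : Fin 5} {u w : ℕ → V} {a b : ℕ}
  (hu0 : u 0 = c 1) (hw0 : w 0 = c q)
  (hufresh : ∀ i, 0 < i → i ≤ a → ∀ f ∈ E₀ ∪ Cyc.edgeSet b w, u i ∈ f → f.IsDiag)
  (hwfresh : ∀ i, 0 < i → i ≤ b → ∀ f ∈ E₀, w i ∈ f → f.IsDiag)
  (huinj : ∀ i j, i ≤ a → j ≤ a → u i = u j → i = j) (hwinj : ∀ i j, i ≤ b → j ≤ b → w i = w j → i = j)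
  (hsu : ∀ i, 0 < i → i ≤ a → c 0 ≠ u i) (hsw : ∀ i, 0 < i → i ≤ b → c 0 ≠ w i)
  (hPw : ∀ i, 0 < i → i ≤ b → c 1 ≠ w i) (hzu : ∀ i, 0 < i → i ≤ a → w b ≠ u i)
include hu0 hw0 hufresh hwfresh huinj hwinj hsu hsw hPw hzu

/-- **THEOREM K5H (`K₅` + handle, all arm lengths).**  `K₅` on `c 0 = s, …, c 4` (`c` injective, image edge set `E₀`), a handle from `P = c 1`
to `Q = c q` (any `q`; arms of fresh vertices), `x` fresh joined to `y, z`, `yz ∉ H = E₀ ∪ arms`, `E = H + xy + xz` (`H` written as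
`(arm ∪ stub) ∪ E₀`: a statement about `K₅`, cf. …AntitheticK4Handle / …AntitheticW4Handle).  Then for all monotone `F, G`:
`0 ≤ Σ_{ω : ¬(x ∈ X_E ω ∧ x ∈ Y_E ω)} (F(X_E ω) − F(Y_E ω))·(G(X_E ω) − G(Y_E ω))`. [this work] -/
theorem handle_vertex_sum_nonneg {x : V}
    (hx : ∀ f ∈ (Cyc.edgeSet a u ∪ Cyc.edgeSet b w) ∪ E₀, x ∈ f → f.IsDiag)
    (hxs : x ≠ c 0) (hxy : x ≠ u a) (hxz : x ≠ w b) (hyz : u a ≠ w b) (hg : s(u a, w b) ∉ (Cyc.edgeSet a u ∪ Cyc.edgeSet b w) ∪ E₀)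
    {F G : Set V → ℝ} (hF : Monotone F) (hG : Monotone G) :
    0 ≤ ∑ ω ∈ Finset.univ.filter (fun ω : Set (Sym2 V) =>
        ¬ ((openGraph (ω ∩ insert s(x, u a) (insert s(x, w b) ((Cyc.edgeSet a u ∪ Cyc.edgeSet b w) ∪ E₀)))).Reachable (c 0) x ∧
          (openGraph (ωᶜ ∩ insert s(x, u a) (insert s(x, w b) ((Cyc.edgeSet a u ∪ Cyc.edgeSet b w) ∪ E₀)))).Reachable (c 0) x)),
      (F (openCluster (ω ∩ insert s(x, u a) (insert s(x, w b) ((Cyc.edgeSet a u ∪ Cyc.edgeSet b w) ∪ E₀))) (c 0)) -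
          F (openCluster (ωᶜ ∩ insert s(x, u a) (insert s(x, w b) ((Cyc.edgeSet a u ∪ Cyc.edgeSet b w) ∪ E₀))) (c 0))) *
        (G (openCluster (ω ∩ insert s(x, u a) (insert s(x, w b) ((Cyc.edgeSet a u ∪ Cyc.edgeSet b w) ∪ E₀))) (c 0)) -
          G (openCluster (ωᶜ ∩ insert s(x, u a) (insert s(x, w b) ((Cyc.edgeSet a u ∪ Cyc.edgeSet b w) ∪ E₀))) (c 0))) := by
  -- (the edge set of `H` is written `(arm ∪ stub) ∪ E₀`; the dual handle theorem writes `arm ∪ (E₀ ∪ stub)`)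
  have hcomm : (Cyc.edgeSet a u ∪ Cyc.edgeSet b w) ∪ E₀ = Cyc.edgeSet a u ∪ (E₀ ∪ Cyc.edgeSet b w) := by
    rw [Set.union_assoc, Set.union_comm (Cyc.edgeSet b w)]
  rw [hcomm] at hx hg ⊢
  -- bookkeeping (inlined: no loops, every vertex an apex)
  have hKd : ∀ e ∈ ({s(0, 1), s(0, 2), s(0, 3), s(0, 4), s(1, 2), s(1, 3), s(1, 4), s(2, 3), s(2, 4), s(3, 4)} : Finset (Sym2 (Fin 5))),
      ¬ e.IsDiag := by decide
  have hnd : ∀ f ∈ E₀, ¬ f.IsDiag := by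
    rw [hE₀]
    rintro f ⟨e, he, rfl⟩
    have hne := hKd e (Finset.mem_coe.1 he)
    induction e using Sym2.ind with
    | h i j =>
      rw [Sym2.map_mk, Sym2.mk_isDiag_iff]
      rw [Sym2.mk_isDiag_iff] at hne
      exact fun h => hne (hc h)
  have hKa : ∀ i j : Fin 5, i ≠ j →
      s(i, j) ∈ ({s(0, 1), s(0, 2), s(0, 3), s(0, 4), s(1, 2), s(1, 3), s(1, 4), s(2, 3), s(2, 4), s(3, 4)} : Finset (Sym2 (Fin 5))) := by
    decide
  have hapex : ∀ e ∈ E₀, ∀ v ∈ e, v ≠ c q → s(v, c q) ∈ E₀ := by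
    rw [hE₀]
    rintro f ⟨e, he, rfl⟩ v hv hvq
    induction e using Sym2.ind with
    | h i j =>
      rw [Sym2.map_mk] at hv
      have hv' : ∃ k, v = c k := by
        rcases Sym2.mem_iff.1 hv with rfl | rfl
        · exact ⟨i, rfl⟩
        · exact ⟨j, rfl⟩
      obtain ⟨k, rfl⟩ := hv'
      have hkq : k ≠ q := fun h => hvq (by rw [h])
      exact ⟨s(k, q), Finset.mem_coe.2 (hKa k q hkq), Sym2.map_mk _ _ _⟩
  -- (⊕): the checked certificate on `Fin 5`, transported along `c`
  --      (the certificate file carries the computable `Decidable` instance of `SimpleGraph.Reachable`; `convert` + `Finset.filter_congr`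
  --      identify its event filter with the classical one of the transport lemma without unfolding either instance)
  have hop := fun (K₁ K₂ : Set V → Set V → ℝ) hK₁ hso₁ hK₂ hso₂ =>
    Transport.oplus_of_powerset hc ({s(0, 1), s(0, 2), s(0, 3), s(0, 4), s(1, 2), s(1, 3), s(1, 4), s(2, 3), s(2, 4), s(3,
    4)} : Finset (Sym2 (Fin 5))) 0 1
      (fun L₁ L₂ hL₁ hsoL₁ hL₂ hsoL₂ => by
        convert oplus_powerset L₁ L₂ hL₁ hsoL₁ hL₂ hsoL₂ using 9)
      hE₀ K₁ K₂ hK₁ hso₁ hK₂ hso₂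
  -- (M): `c q` is an apex
  have hmix := fun (K₁ K₂ : Set V → Set V → ℝ) hK₁ hso₁ hK₂ hso₂ =>
    Apex.mixed_nonneg (E := E₀) (s := c 0) hapex (c 1) K₁ K₂ hK₁ hso₁ hK₂ hso₂
  have h := Pendant.handle_vertex_sum_nonneg_of_oplus hnd hwfresh hwinj hsw hPw hop hu0 hw0 hufresh huinj hsu hzu hmix
    hx hxs hxy hxz hyz hg hF hG
  -- (the two sides may carry different `Decidable` instances for the event; `convert` identifies them)
  convert h using 3

end K5

end Antithetic

end Summit.CriticalPhenomena.PercolationContinuityZ3.Theorems
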